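import Summits.QuantumFields.BalabanUV.T4Continuum.Spine.NE7.QLaBlockAvgOneStep
import Literature.MathematicalPhysics.QuantumFieldTheory.Balaban1983to89.T4ApexPrinted

/-!
# Spine/NE7/QLaBlockAvgContraction — `BondDevBound` ∕ `HolDevBound` ∕ `LoopDefectBound` and NODE S's chain END TO END FOR THE PRINTED
# PRESCRIPTION [Balaban1987RG1] (0.4) `blockAvg expMeanLogSU` ON `SU(N)` — the averaging class of the headline
# `continuumYM4_torus_of_BetaPertH` (`IsPrintedAveraged₁`) — with the printed rate `θ = L^{1−d}` and constant `e`

Cell `pub-balaban-gaps` (YM blitz Y1, track G2, seat `ne7`, generation 8); text of record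
`run/shared/lean/pub/pub-balaban-gaps/ne/NE7.md` v8 §4nonies, census rows R52–R54.  Twenty-ninth `Spine/NE7/` file; last of the five
files `QLaBlockAvgFramedStep` ∕ `QLaBlockAvgEML` ∕ `QLaBlockAvgLinear` ∕ `QLaBlockAvgOneStep` ∕ `QLaBlockAvgContraction` of generation 8
(see the first for WHY).
WHAT IS PROVED ([folklore] bookkeeping, kernel-checked, 0 sorry):
* `sum_remMass_le`, `tv_framed_le`: summing the per-bond estimate of `QLaBlockAvgOneStep` over the coarse bonds — on the sup-ball
  `dist1 V_b ≤ ρ` (`ℓρ < δ_N`, `ℓρ ≤ ½`) the framed one-step average satisfies `tv(1, F(V)) ≤ (θ + 872·d·ℓ²·ρ)·tv(1, V)`, `θ = L^{1−d}`;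
* `dom`, `rad`: the shrinking sup-ball domains `dist1 V_b ≤ ρ_j = ρ⋆·(16ℓ)^{−(m+K−j)}`, `ρ⋆ = min(δ_N/(4ℓ), θ/(2·872dℓ²))` (OUR choice,
  of the KIND of [Balaban1985Averaging] (158) `|A| < α₁` on the `η`-lattice: the radius shrinks geometrically down the levels; census
  R43∕R46), on which `F` maps `dom_j` into `dom_{j+1}` and `Σ_j 872dℓ²ρ_j/θ ≤ 1`;
* `flatStepContraction_blockAvgSU` (the shape of `QLaBlockAvgFramedStep` §1), `prod_factor_le` (`∏_{i<n}(θ + Kρ_{k+i}) ≤ e·θⁿ`);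
* **`bondDevBound_blockAvgSU`, `holDevBound_blockAvgSU`, `loopDefectBound_blockAvgSU`**: generation 4's `BondDevBound` ∕ `HolDevBound`
  (constant `e`) and generation 3's `LoopDefectBound` (constant `e²/2`, criticality `reTrCrit_specialUnitaryGroup`) with rate
  `θ = L^{1−d}` FOR `fun j => blockAvg expMeanLogSU` on `SU(N)`;
* **`abs_log_quotient_sub_le_blockAvgSU`**: NODE S's chain end to end (the twin of `abs_log_quotient_sub_le_linAvg` (file 10) and
  `abs_log_quotient_sub_le_avgB7` (file 20)) for the printed prescription;
* **`holDevBound_of_isPrintedAveraged₁`, `loopDefectBound_of_isPrintedAveraged₁`**: for every finite-`ε` datum `D` over `SU(N)` in the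
  headline's one-level printed class (`D.IsPrintedAveraged₁`, `T4ApexPrinted`) and every cutoff `K`, NODE S's holonomy-level input
  holds for THE DATUM'S OWN averaging maps `D.av K`.

HONEST FRAMING.  This closes census R45's fork (b-ii) ∕ R34 in the FLAT-REFERENCE form NODE S consumes: the non-vacuity
certificate of NODE S's chain is now an instance of the HEADLINE's averaging-and-group class (one-level prescription (0.4); the two-level
prescription (0.10)–(0.12) `IsPrintedAveraged₂` is NOT treated).  It is NOT the two-configuration NE1a-STEP of row O3c, NOT Bałaban's
Props 3–5 on the (52)/(158) domains, says nothing about Bałaban's densities, R-operation or (1.100) insert, and the domains are ours.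
(QL-a) NOT IN PRINT ([Balaban1989LargeFieldII] p. 356 defers observables); NE7 NOT proved; spine 0∕9; fixed finite T⁴ — NOT ℝ⁴, NOT
infinite volume, NOT a mass gap, NOT Clay.
-/

noncomputable section
open Finset
open scoped BigOperators Matrix Matrix.Norms.L2Operator

namespace Summit.QuantumFields.BalabanUV.T4Continuum.Spine.NE7

open Literature.MathematicalPhysics.QuantumFieldTheory.Balaban1983to89
open Literature.MathematicalPhysics.QuantumFieldTheory.Balaban1983to89.T4Continuum
open Literature.MathematicalPhysics.QuantumFieldTheory.Balaban1983to89.T4AvgSensitivity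
open Literature.MathematicalPhysics.QuantumFieldTheory.Balaban1983to89.T4AvgDerivBound
open Literature.MathematicalPhysics.QuantumFieldTheory.Balaban1983to89.BlockAveraging (Idx off loopHol blockAvg blockAvg_avg
  blockOf_src_of_mem_walk)
open ExpMeanLog

section SUN

variable {n : Type*} [Fintype n] [DecidableEq n] [Nonempty n]
variable {P : Params} {j : ℕ}

/-! ## §1 Summing the per-bond estimate over the coarse bonds: the framed one-step contraction from the flat configuration -/

/-- THE REMAINDER MASSES DOUBLE-COUNT each fine bond at most `8dℓ` times: `Σ_c remMass(V,c) ≤ 8·d·ℓ·tv(1,V)`. [folklore] -/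
theorem sum_remMass_le (hj : j + 1 ≤ P.m + P.K) (V : GaugeField P j (Matrix.specialUnitaryGroup n ℂ)) :
    ∑ c : PBond P (j + 1), remMass V c ≤ 8 * P.d * ell P * tv 1 V := by
  have hℓ : (0 : ℝ) ≤ ell P := Nat.cast_nonneg _
  -- each piece ≤ ℓ · (two block sums)
  have hst : ∀ (y : Site P (j + 1)) (μ : Fin P.d),
      stairMass V y ≤ ell P * (blockSum V y + blockSum V (y.shift μ)) := fun y μ => by
    refine meanR_le_of_le fun i => ?_
    refine (walkMass_le_of_support V _ (blockOf_src_of_mem_stairWalk hj y μ i)).trans ?_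
    refine mul_le_mul_of_nonneg_right ?_ (add_nonneg (blockSum_nonneg V _) (blockSum_nonneg V _))
    rw [length_walk]
    have h := length_stairWord_le (P := P) i.2.1 i.1
    have : P.d * P.L ≤ ell P := by unfold ell; nlinarith
    exact_mod_cast h.trans this
  have hlp : ∀ c : PBond P (j + 1), loopMass V c ≤ ell P * (blockSum V c.src + blockSum V c.tgt) := fun c => by
    refine meanR_le_of_le fun i => ?_
    refine (walkMass_le_of_support V _ (blockOf_src_of_mem_walk hj c i)).trans ?_
    refine mul_le_mul_of_nonneg_right ?_ (add_nonneg (blockSum_nonneg V _) (blockSum_nonneg V _))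
    rw [length_walk]
    exact_mod_cast length_loopWord_le (P := P) c.dir i.1 i.2.1 i.2.2
  have hax : ∀ c : PBond P (j + 1), axMass V c ≤ ell P * (blockSum V c.src + blockSum V c.tgt) := fun c => by
    refine (walkMass_le_of_support V _ (blockOf_src_of_mem_axWalk hj c)).trans ?_
    refine mul_le_mul_of_nonneg_right ?_ (add_nonneg (blockSum_nonneg V _) (blockSum_nonneg V _))
    rw [length_walk, List.length_replicate]
    have : P.L ≤ ell P := by unfold ell; nlinarith
    exact_mod_cast this
  have hsrc := sum_blockSum_le V (fun c : PBond P (j + 1) => c.src) injective_src_dir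
  have htgt := sum_blockSum_le V (fun c : PBond P (j + 1) => c.tgt) injective_tgt_dir
  have hsh := sum_blockSum_le V (fun c : PBond P (j + 1) => c.tgt.shift c.dir) injective_tgt_shift_dir
  calc ∑ c : PBond P (j + 1), remMass V c
      ≤ ∑ c : PBond P (j + 1), ell P * (3 * blockSum V c.src + 4 * blockSum V c.tgt + blockSum V (c.tgt.shift c.dir)) :=
        Finset.sum_le_sum fun c _ => by
          have := hst c.src c.dir; have := hlp c; have := hax c; have := hst c.tgt c.dir
          rw [remMass]
          have e : (⟨c.src, c.dir⟩ : PBond P (j + 1)).tgt = c.tgt := rfl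
          simp only [PBond.tgt] at *
          nlinarith [blockSum_nonneg V c.src, blockSum_nonneg V (c.src.shift c.dir)]
    _ = ell P * (3 * ∑ c : PBond P (j + 1), blockSum V c.src + 4 * ∑ c : PBond P (j + 1), blockSum V c.tgt
          + ∑ c : PBond P (j + 1), blockSum V (c.tgt.shift c.dir)) := by
        rw [← Finset.mul_sum, Finset.sum_add_distrib, Finset.sum_add_distrib, Finset.mul_sum, Finset.mul_sum]
    _ ≤ ell P * (3 * (P.d * tv 1 V) + 4 * (P.d * tv 1 V) + P.d * tv 1 V) := by gcongr
    _ = 8 * P.d * ell P * tv 1 V := by ring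

/-- **THE FRAMED ONE-STEP CONTRACTION FROM THE FLAT CONFIGURATION** for the printed prescription `blockAvg expMeanLogSU` on `SU(N)`:
on the sup-ball `dist1 V_b ≤ ρ` (`ℓρ < δ_N`, `ℓρ ≤ ½`), `tv(1, F(V)) ≤ (θ + 872·d·ℓ²·ρ) · tv(1, V)`, `θ = L^{1−d}` — the printed rate
[Balaban1985Averaging] (156)/(138) at the flat configuration plus a second-order correction proportional to the radius. [folklore] -/
theorem tv_framed_le (hj : j + 1 ≤ P.m + P.K) (V : GaugeField P j (Matrix.specialUnitaryGroup n ℂ)) {ρ : ℝ}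
    (hρ : 0 ≤ ρ) (hV : ∀ b, dist1 (V b) ≤ ρ) (hδ : ell P * ρ < deltaSU n) (h2 : ell P * ρ ≤ 1 / 2) :
    tv 1 (framed V) ≤ (theta P + 872 * P.d * (ell P : ℝ) ^ 2 * ρ) * tv 1 V := by
  rw [tv_one_eq (framed V)]
  have hη0 : 0 ≤ 109 * (ell P * ρ) := by positivity
  calc ∑ c : PBond P (j + 1), dist1 (framed V c)
      ≤ ∑ c : PBond P (j + 1), (segMass V c + 109 * (ell P * ρ) * remMass V c) :=
        Finset.sum_le_sum fun c _ => dist1_framed_le hj V hρ hV hδ h2 c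
    _ = ∑ c : PBond P (j + 1), segMass V c + 109 * (ell P * ρ) * ∑ c : PBond P (j + 1), remMass V c := by
        rw [Finset.sum_add_distrib, Finset.mul_sum]
    _ ≤ theta P * tv 1 V + 109 * (ell P * ρ) * (8 * P.d * ell P * tv 1 V) :=
        add_le_add (sum_mean_segMass_le hj V) (mul_le_mul_of_nonneg_left (sum_remMass_le hj V) hη0)
    _ = (theta P + 872 * P.d * (ell P : ℝ) ^ 2 * ρ) * tv 1 V := by ring


/-! ## §2 The shrinking sup-ball domains and the one-step framed contraction on them -/

/-- `K₁ = 872·d·ℓ²`: the coefficient of the radius in the one-step contraction factor. [folklore] -/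
def K1 (P : Params) : ℝ := 872 * P.d * (ell P : ℝ) ^ 2

/-- `ρ⋆ = min(δ_N/(4ℓ), θ/(2K₁))`: the top radius (guard of the printed `log` and summability of the corrections). [folklore] -/
def radStar (P : Params) (n : Type*) [Fintype n] : ℝ := min (deltaSU n / (4 * ell P)) (theta P / (2 * K1 P))

/-- THE DOMAIN RADIUS AT LEVEL `j`: `ρ_j = ρ⋆·(16ℓ)^{−(m+K−j)}` — shrinking geometrically DOWN the levels, so that the framed average
maps the level-`j` ball into the level-`(j+1)` ball (`dist1 F(V)(c) ≤ 16ℓρ_j = ρ_{j+1}`); of the KIND of [Balaban1985Averaging] (158).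
[cite: Balaban1985Averaging, (158) p.42] -/
def rad (P : Params) (n : Type*) [Fintype n] (j : ℕ) : ℝ := radStar P n * ((16 * ell P : ℝ)⁻¹) ^ (P.m + P.K - j)

/-- THE DOMAIN FAMILY: sup-balls `dist1 V_b ≤ ρ_j` about the flat configuration. [folklore] -/
def dom (P : Params) (n : Type*) [Fintype n] [DecidableEq n] [Nonempty n] (j : ℕ) :
    Set (GaugeField P j (Matrix.specialUnitaryGroup n ℂ)) :=
  {V | ∀ b, dist1 (V b) ≤ rad P n j}

/-- `0 < ℓ`. [folklore] -/
theorem ell_pos (P : Params) : (0 : ℝ) < ell P := by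
  have := P.hd; have := P.L_pos
  unfold ell; positivity

/-- `1 ≤ ℓ`. [folklore] -/
theorem one_le_ell (P : Params) : (1 : ℝ) ≤ ell P := by
  have := P.hd; have := P.hL.2
  exact_mod_cast (show 1 ≤ ell P by unfold ell; nlinarith)

/-- `0 < θ`. [folklore] -/
theorem theta_pos (P : Params) : 0 < theta P := by
  have := P.L_pos
  unfold theta; positivity

/-- `0 < K₁`. [folklore] -/
theorem K1_pos (P : Params) : 0 < K1 P := by
  have := P.hd; have := ell_pos P
  unfold K1; positivity

/-- `0 < ρ⋆`. [folklore] -/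
theorem radStar_pos (P : Params) (n : Type*) [Fintype n] [Nonempty n] : 0 < radStar P n :=
  lt_min (div_pos deltaSU_pos (by have := ell_pos P; positivity))
    (div_pos (theta_pos P) (by have := K1_pos P; positivity))

/-- `0 ≤ ρ_j`. [folklore] -/
theorem rad_nonneg (P : Params) (n : Type*) [Fintype n] [Nonempty n] (j : ℕ) : 0 ≤ rad P n j :=
  mul_nonneg (radStar_pos P n).le (pow_nonneg (inv_nonneg.mpr (by have := ell_pos P; positivity)) _)

/-- `ρ_j ≤ ρ⋆`. [folklore] -/
theorem rad_le_radStar (P : Params) (n : Type*) [Fintype n] [Nonempty n] (j : ℕ) : rad P n j ≤ radStar P n := by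
  unfold rad
  refine mul_le_of_le_one_right (radStar_pos P n).le (pow_le_one₀ (inv_nonneg.mpr ?_) ?_)
  · have := ell_pos P; positivity
  · rw [inv_le_one_iff₀]; right; have := one_le_ell P; linarith

/-- `ℓ·ρ_j < δ_N` (the printed `log` of (0.4) is on its domain) and `ℓ·ρ_j ≤ ½`. [folklore] -/
theorem ell_mul_rad (P : Params) (n : Type*) [Fintype n] [Nonempty n] (j : ℕ) :
    ell P * rad P n j < deltaSU n ∧ ell P * rad P n j ≤ 1 / 2 := by
  have hℓ := ell_pos P
  have hδ : 0 < deltaSU n := deltaSU_pos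
  have hδ3 : deltaSU n ≤ 1 / 3 := min_le_left _ _
  have h1 : ell P * rad P n j ≤ deltaSU n / 4 := by
    calc ell P * rad P n j ≤ ell P * (deltaSU n / (4 * ell P)) :=
          mul_le_mul_of_nonneg_left ((rad_le_radStar P n j).trans (min_le_left _ _)) hℓ.le
      _ = deltaSU n / 4 := by field_simp
  exact ⟨by linarith, by linarith⟩

/-- `ρ_{j+1} = 16ℓ·ρ_j` in the standing range. [folklore] -/
theorem rad_succ (P : Params) (n : Type*) [Fintype n] {j : ℕ} (hj : j + 1 ≤ P.m + P.K) :
    rad P n (j + 1) = 16 * ell P * rad P n j := by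
  have hℓ : (16 * ell P : ℝ) ≠ 0 := by have := ell_pos P; positivity
  have he : P.m + P.K - j = (P.m + P.K - (j + 1)) + 1 := by omega
  have hq : (16 * (ell P : ℝ)) * (16 * (ell P : ℝ))⁻¹ = 1 := mul_inv_cancel₀ hℓ
  unfold rad
  rw [he, pow_succ]
  linear_combination (-(radStar P n * ((16 * (ell P : ℝ))⁻¹) ^ (P.m + P.K - (j + 1)))) * hq

/-- The trivial configuration is in every domain. [folklore] -/
theorem one_mem_dom (j : ℕ) : (1 : GaugeField P j (Matrix.specialUnitaryGroup n ℂ)) ∈ dom P n j := fun b => by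
  rw [show (1 : GaugeField P j (Matrix.specialUnitaryGroup n ℂ)) b = 1 from rfl, GaugeGroup.dist1_one]
  exact rad_nonneg P n j

/-- **`FlatStepContraction` FOR THE PRINTED PRESCRIPTION ON `SU(N)`** with factors `θ + K₁ρ_j`: the frame is `QLaBlockAvgOneStep.frameTransf`,
the framed average stays in the next ball (`dist1_framed_le_sup`, `ρ_{j+1} = 16ℓρ_j`) and contracts total variation from the flat
configuration (`tv_framed_le`). [folklore] -/
theorem flatStepContraction_blockAvgSU :
    FlatStepContraction (fun j => (blockAvg (expMeanLogSU (n := n)) : Averaging P j (Matrix.specialUnitaryGroup n ℂ))) (dom P n)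
      (fun j => theta P + K1 P * rad P n j) := by
  intro j hj V hV
  obtain ⟨hδ, h2⟩ := ell_mul_rad P n j
  refine ⟨frameTransf V, fun c => ?_, ?_⟩
  · show dist1 (framed V c) ≤ rad P n (j + 1)
    rw [rad_succ P n hj]
    have := dist1_framed_le_sup hj V (rad_nonneg P n j) hV hδ h2 c
    linarith
  · show tv 1 (framed V) ≤ (theta P + K1 P * rad P n j) * tv 1 V
    have := tv_framed_le hj V (rad_nonneg P n j) hV hδ h2
    simpa only [K1, mul_assoc] using this

/-! ## §3 The level factors compose to `e·θⁿ` -/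

/-- A geometric tail with ratio `q ≤ ½`: `Σ_{i<n'} q^{E−i} ≤ 2q^{E−n'+1}` for `n' ≤ E`. [folklore] -/
theorem geomTail_le {q : ℝ} (hq0 : 0 ≤ q) (hq : 2 * q ≤ 1) (E : ℕ) :
    ∀ n' : ℕ, n' ≤ E → ∑ i ∈ range n', q ^ (E - i) ≤ 2 * q ^ (E - n' + 1)
  | 0, _ => by simp; positivity
  | n' + 1, hn => by
    rw [Finset.sum_range_succ]
    have ih := geomTail_le hq0 hq E n' (by omega)
    have he : E - n' + 1 = (E - (n' + 1) + 1) + 1 := by omega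
    have he' : E - n' = E - (n' + 1) + 1 := by omega
    rw [he] at ih
    rw [he']
    have hp : 0 ≤ q ^ (E - (n' + 1) + 1) := pow_nonneg hq0 _
    calc ∑ i ∈ range n', q ^ (E - i) + q ^ (E - (n' + 1) + 1)
        ≤ 2 * q ^ (E - (n' + 1) + 1 + 1) + q ^ (E - (n' + 1) + 1) := by linarith
      _ = (2 * q) * q ^ (E - (n' + 1) + 1) + q ^ (E - (n' + 1) + 1) := by ring
      _ ≤ 1 * q ^ (E - (n' + 1) + 1) + q ^ (E - (n' + 1) + 1) := by gcongr
      _ = 2 * q ^ (E - (n' + 1) + 1) := by ring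

/-- THE RADII SUM TO AT MOST `ρ⋆` along any stretch of levels in the standing range. [folklore] -/
theorem sum_rad_le (P : Params) (n : Type*) [Fintype n] [Nonempty n] {k n' : ℕ} (hkn : k + n' ≤ P.m + P.K) :
    ∑ i ∈ range n', rad P n (k + i) ≤ radStar P n := by
  have hℓ := ell_pos P
  set q : ℝ := (16 * ell P : ℝ)⁻¹ with hq
  have hq0 : 0 ≤ q := by positivity
  have hq1 : q ≤ 1 := by
    rw [hq, inv_le_one_iff₀]; right
    have := one_le_ell P
    linarith
  have hq2 : 2 * q ≤ 1 := by
    rw [hq]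
    have : (2 : ℝ) ≤ 16 * ell P := by
      have := one_le_ell P
      linarith
    calc 2 * (16 * ell P : ℝ)⁻¹ = 2 / (16 * ell P) := by ring
      _ ≤ 1 := by rw [div_le_one (by positivity)]; exact this
  have hsum : ∑ i ∈ range n', rad P n (k + i) = radStar P n * ∑ i ∈ range n', q ^ ((P.m + P.K - k) - i) := by
    rw [Finset.mul_sum]
    refine Finset.sum_congr rfl fun i _ => ?_
    unfold rad
    rw [Nat.sub_sub]
  rw [hsum]
  refine mul_le_of_le_one_right (radStar_pos P n).le ?_
  refine (geomTail_le hq0 hq2 (P.m + P.K - k) n' (by omega)).trans ?_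
  calc 2 * q ^ (P.m + P.K - k - n' + 1) = (2 * q) * q ^ (P.m + P.K - k - n') := by ring
    _ ≤ 1 * 1 := mul_le_mul hq2 (pow_le_one₀ hq0 hq1) (pow_nonneg hq0 _) zero_le_one
    _ = 1 := by ring

/-- **THE LEVEL FACTORS COMPOSE TO `e·θⁿ`**: `∏_{i<n'} (θ + K₁ρ_{k+i}) ≤ e·θ^{n'}` in the standing range (`θ + K₁ρ ≤ θ·e^{K₁ρ/θ}` and
`Σ_i K₁ρ_{k+i}/θ ≤ K₁ρ⋆/θ ≤ ½`). [folklore] -/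
theorem prod_factor_le (P : Params) (n : Type*) [Fintype n] [Nonempty n] {k n' : ℕ} (hkn : k + n' ≤ P.m + P.K) :
    ∏ i ∈ range n', (theta P + K1 P * rad P n (k + i)) ≤ Real.exp 1 * theta P ^ n' := by
  have hθ := theta_pos P
  have hK := K1_pos P
  have hfac : ∀ i ∈ range n', theta P + K1 P * rad P n (k + i) ≤ theta P * Real.exp (K1 P / theta P * rad P n (k + i)) := by
    intro i _
    have h1 := Real.add_one_le_exp (K1 P / theta P * rad P n (k + i))
    have hθinv : theta P * (theta P)⁻¹ = 1 := mul_inv_cancel₀ hθ.ne'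
    have e : theta P * (K1 P / theta P * rad P n (k + i) + 1) = theta P + K1 P * rad P n (k + i) := by
      rw [div_eq_mul_inv]
      linear_combination (K1 P * rad P n (k + i)) * hθinv
    calc theta P + K1 P * rad P n (k + i) = theta P * (K1 P / theta P * rad P n (k + i) + 1) := e.symm
      _ ≤ theta P * Real.exp (K1 P / theta P * rad P n (k + i)) := mul_le_mul_of_nonneg_left h1 hθ.le
  have hpos : ∀ i ∈ range n', 0 ≤ theta P + K1 P * rad P n (k + i) := fun i _ =>
    add_nonneg hθ.le (mul_nonneg hK.le (rad_nonneg P n _))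
  have hsum : ∑ i ∈ range n', K1 P / theta P * rad P n (k + i) ≤ 1 := by
    rw [← Finset.mul_sum]
    calc K1 P / theta P * ∑ i ∈ range n', rad P n (k + i) ≤ K1 P / theta P * radStar P n :=
          mul_le_mul_of_nonneg_left (sum_rad_le P n hkn) (by positivity)
      _ ≤ K1 P / theta P * (theta P / (2 * K1 P)) := mul_le_mul_of_nonneg_left (min_le_right _ _) (by positivity)
      _ = 1 / 2 := by
          rw [div_mul_div_comm, div_eq_iff (by positivity)]
          ring
      _ ≤ 1 := by norm_num
  calc ∏ i ∈ range n', (theta P + K1 P * rad P n (k + i))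
      ≤ ∏ i ∈ range n', theta P * Real.exp (K1 P / theta P * rad P n (k + i)) := Finset.prod_le_prod hpos hfac
    _ = theta P ^ n' * Real.exp (∑ i ∈ range n', K1 P / theta P * rad P n (k + i)) := by
        rw [Finset.prod_mul_distrib, Finset.prod_const, Finset.card_range, Real.exp_sum]
    _ ≤ theta P ^ n' * Real.exp 1 := by gcongr
    _ = Real.exp 1 * theta P ^ n' := mul_comm _ _

/-- SANITY (decided arithmetic) at the cell's point `(d, L) = (4, 3)`: `ℓ = 2·5·3 = 30`. [folklore] -/
example : ell ⟨4, 3, 1, 1, by norm_num, ⟨1, rfl⟩, by norm_num⟩ = 30 := by norm_num [ell]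

/-- SANITY (decided arithmetic) at `(d, L) = (4, 3)`: `K₁ = 872·4·30² = 3 139 200`, so `θ/(2K₁) = (1/27)/6 278 400 ≈ 5.90·10⁻⁹` is the
top radius `ρ⋆` for every `N ≤ 4·10⁵` (census R54). [folklore] -/
example : K1 ⟨4, 3, 1, 1, by norm_num, ⟨1, rfl⟩, by norm_num⟩ = 3139200 := by norm_num [K1, ell]

/-! ## §4 `BondDevBound`, `HolDevBound`, `LoopDefectBound` and NODE S's chain for the printed prescription on `SU(N)` -/

/-- **`BondDevBound (blockAvg expMeanLogSU) dom e θ`, `θ = L^{1−d}`** — generation 4's per-coarse-bond shape FOR THE PRINTED PRESCRIPTION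
[Balaban1987RG1] (0.4) ON `SU(N)`: in the accumulated frame gauge every coarse bond of `avgⁿ V` is within `e·θⁿ·tv(1,V)` of the identity.
[folklore] -/
theorem bondDevBound_blockAvgSU :
    BondDevBound (fun j => (blockAvg (expMeanLogSU (n := n)) : Averaging P j (Matrix.specialUnitaryGroup n ℂ))) (dom P n)
      (Real.exp 1) (theta P) :=
  bondDevBound_of_flatStepContraction flatStepContraction_blockAvgSU
    (fun j => add_nonneg (theta_nonneg P) (mul_nonneg (K1_pos P).le (rad_nonneg P n j)))
    fun _ _ hkn => prod_factor_le P n hkn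

/-- **`HolDevBound (blockAvg expMeanLogSU) dom e θ`** — NODE S's holonomy-level input (file 8) for the printed prescription on `SU(N)`.
[folklore] -/
theorem holDevBound_blockAvgSU :
    HolDevBound (fun j => (blockAvg (expMeanLogSU (n := n)) : Averaging P j (Matrix.specialUnitaryGroup n ℂ))) (dom P n)
      (Real.exp 1) (theta P) :=
  holDevBound_of_bondDevBound bondDevBound_blockAvgSU

/-- **`LoopDefectBound (blockAvg expMeanLogSU) dom (e²/2) θ`** — generation 3's second-order loop-defect bound for the printed prescription
on `SU(N)`, by criticality of `Re tr` on `SU(N)` (`reTrCrit_specialUnitaryGroup`, `Cc = ½`):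
`0 ≤ 1 − W(avgⁿ V) ≤ (e²/2)·(|w|·tv(1,V)·θⁿ)²`. [folklore] -/
theorem loopDefectBound_blockAvgSU :
    LoopDefectBound (fun j => (blockAvg (expMeanLogSU (n := n)) : Averaging P j (Matrix.specialUnitaryGroup n ℂ))) (dom P n)
      (1 / 2 * Real.exp 1 ^ 2) (theta P) :=
  loopDefectBound_of_holDevBound reTrCrit_specialUnitaryGroup (by norm_num) holDevBound_blockAvgSU

/-- **NODE S's CHAIN END TO END FOR THE PRINTED PRESCRIPTION (0.4) ON `SU(N)`** (the twin of file 10's `abs_log_quotient_sub_le_linAvg`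
and file 20's `abs_log_quotient_sub_le_avgB7`): for ANY two probability laws `ν₁, ν₂` on level-`k` configurations with values in the
domain, trivial off a finite bond set `Λ` with one-bond deviations `≤ D`, every closed walk `w` of `T^{(k+n′)}` and every source strength
`t`, `|log ∫e^{t(W−1)}dν₁ − log ∫e^{t(W−1)}dν₂| ≤ 2|t|·(e²/2)·(|w|·|Λ|·D)²·(θ²)^{n′}`, `θ = L^{1−d}`.  No property of the laws beyond the
support is used; what NODE S still takes from elsewhere is the FORMAT (W-fmt@1 — NODE O) and the (0.26) census of `Λ`. [folklore] -/
theorem abs_log_quotient_sub_le_blockAvgSU {Ω : Type*} [MeasurableSpace Ω] (ν₁ ν₂ : MeasureTheory.Measure Ω)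
    [MeasureTheory.IsProbabilityMeasure ν₁] [MeasureTheory.IsProbabilityMeasure ν₂] {k n' : ℕ} (hn : k + n' ≤ P.m + P.K)
    (x : Site P (k + n')) (w : List (T4Continuum.Letter P.d)) (hw : walkEnd x w = x)
    (cfg : Ω → GaugeField P k (Matrix.specialUnitaryGroup n ℂ)) (hdom : ∀ ω, cfg ω ∈ dom P n k)
    (Λ : Finset (PBond P k)) {D : ℝ} (hoff : ∀ ω b, b ∉ Λ → cfg ω b = 1) (hD : ∀ ω, ∀ b ∈ Λ, dist1 (cfg ω b) ≤ D)
    (hG₁ : MeasureTheory.AEStronglyMeasurable (fun ω =>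
      loopAt (iterFrom (fun j => (blockAvg (expMeanLogSU (n := n)) : Averaging P j (Matrix.specialUnitaryGroup n ℂ))) k n' (cfg ω))
        (walk x w) - 1) ν₁)
    (hG₂ : MeasureTheory.AEStronglyMeasurable (fun ω =>
      loopAt (iterFrom (fun j => (blockAvg (expMeanLogSU (n := n)) : Averaging P j (Matrix.specialUnitaryGroup n ℂ))) k n' (cfg ω))
        (walk x w) - 1) ν₂)
    (t : ℝ) :
    |Real.log (∫ ω, Real.exp (t * (loopAt (iterFrom (fun j => (blockAvg (expMeanLogSU (n := n)) :
        Averaging P j (Matrix.specialUnitaryGroup n ℂ))) k n' (cfg ω)) (walk x w) - 1)) ∂ν₁)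
      - Real.log (∫ ω, Real.exp (t * (loopAt (iterFrom (fun j => (blockAvg (expMeanLogSU (n := n)) :
        Averaging P j (Matrix.specialUnitaryGroup n ℂ))) k n' (cfg ω)) (walk x w) - 1)) ∂ν₂)|
      ≤ 2 * (|t| * (1 / 2 * Real.exp 1 ^ 2 * ((w.length : ℝ) * Λ.card * D) ^ 2 * (theta P ^ 2) ^ n')) := by
  have key : ∀ ω, |loopAt (iterFrom (fun j => (blockAvg (expMeanLogSU (n := n)) :
      Averaging P j (Matrix.specialUnitaryGroup n ℂ))) k n' (cfg ω)) (walk x w) - 1|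
      ≤ 1 / 2 * Real.exp 1 ^ 2 * ((w.length : ℝ) * Λ.card * D) ^ 2 * (theta P ^ 2) ^ n' := fun ω => by
    have h := loopDefect_le_of_support loopDefectBound_blockAvgSU (by positivity) (theta_nonneg P) hn x w hw (cfg ω)
      (hdom ω) (one_mem_dom k) Λ (fun b hb => hoff ω b hb) (hD ω)
    have h0 := loopDefect_nonneg (iterFrom (fun j => (blockAvg (expMeanLogSU (n := n)) :
      Averaging P j (Matrix.specialUnitaryGroup n ℂ))) k n' (cfg ω)) (walk x w)
    rw [abs_le]
    constructor <;> linarith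
  exact abs_log_integral_exp_sub_le ν₁ ν₂ hG₁ hG₂ (MeasureTheory.ae_of_all _ key) (MeasureTheory.ae_of_all _ key) t

end SUN

/-! ## §5 The headline's printed class: NODE S's input for the datum's own averaging maps -/

section Headline

open Literature.MathematicalPhysics.QuantumFieldTheory.Balaban1983to89.T4Continuum.FiniteEpsData

variable {F : T4Family} {N : ℕ} [NeZero N]

/-- **FOR DATA IN THE HEADLINE'S ONE-LEVEL PRINTED CLASS** (`D.IsPrintedAveraged₁`: the averaging maps of the finite-`ε` datum ARE
[Balaban1987RG1] (0.4) with the printed `exp[mean log]` on `SU(N)`, `T4ApexPrinted`), NODE S's holonomy-level input `HolDevBound` holds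
for THE DATUM'S OWN averaging maps `D.av K` at every cutoff `K`, with the printed rate `θ = L^{1−d}` and constant `e`, on the shrinking
sup-ball domains. [folklore] -/
theorem holDevBound_of_isPrintedAveraged₁ (D : FiniteEpsData F (Matrix.specialUnitaryGroup (Fin N) ℂ)) (hD : D.IsPrintedAveraged₁)
    (K : ℕ) : HolDevBound (D.av K) (dom (F.P K) (Fin N)) (Real.exp 1) (theta (F.P K)) := by
  have h : D.av K = fun j => blockAvg (expMeanLogSU (n := Fin N)) := funext fun j => hD K j
  rw [h]
  exact holDevBound_blockAvgSU

/-- … and generation 3's `LoopDefectBound` (constant `e²/2`) likewise, for the datum's own averaging maps. [folklore] -/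
theorem loopDefectBound_of_isPrintedAveraged₁ (D : FiniteEpsData F (Matrix.specialUnitaryGroup (Fin N) ℂ))
    (hD : D.IsPrintedAveraged₁) (K : ℕ) :
    LoopDefectBound (D.av K) (dom (F.P K) (Fin N)) (1 / 2 * Real.exp 1 ^ 2) (theta (F.P K)) := by
  have h : D.av K = fun j => blockAvg (expMeanLogSU (n := Fin N)) := funext fun j => hD K j
  rw [h]
  exact loopDefectBound_blockAvgSU

end Headline

end Summit.QuantumFields.BalabanUV.T4Continuum.Spine.NE7

end
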